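import Literature.NumberTheory.Automorphic.CDTTheorem722ThreeFactsProofs
import Literature.NumberTheory.EllipticCurves.EisensteinNewformLevelRaising
import Literature.NumberTheory.EllipticCurves.NewformGaloisRepEulerFactors
import Literature.NumberTheory.EllipticCurves.CuspFormLFunctionLevelConductorProofs
import HarnessLib

/-!
# Stub ideation `stub_threeImpTwo` — ideator k = 1, generation 5 (FAMILY 1: recognise & import)

Companion of `STUB-IDEAS-stub_threeImpTwo-1.md` (gen 5).  Helper-lemma SIGNATURES for the stub
prover; `sorry` only inside the M-sized helpers L4, L5, H5 (H5 and the `q ≠ p'` case of L5 are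
PROVED verbatim in the gen-3 companion `STUB_IDEAS_stub_threeImpTwo_1_Sketch.lean`, decls
`H5_isNewformOf_of_forall_prime_cuspCoeff_eq_of_dvd_iff` and the `key` step of
`exists_isNewformOf_of_isModularGaloisRepTate_of_ratGaloisRep_of_carayolEuler`, built on
`H2'_equiv_of_isGaloisRepOfNewform1` / `H3_map_localPolynomialAt_eq` / `H4_cuspCoeff_eq_and_dvd_iff`
there — not imported here because crux-dir modules are not built on the farm snapshot).

NEW in gen 5 (the import): the realisation input of S9 is typed at a FIXED prime,
`RealisationAt p` — verbatim the weight-two / `Γ₀` / rational-coefficient instance of the catalogued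
`Hida2000_thm326_exists_galoisRep` in Carayol's own currency
`IsGaloisRepOfNewform1 g (ι⁻¹ ∘ (K_g ⊆ ℂ)) {q ∣ N p} ρ ∧ irreducible` — and S9 follows from the
realisations at ANY TWO DISTINCT primes `p₁ ≠ p₂` (L6/L7: primes `q ≠ p₁` are read off `ρ_{p₁}` by
Carayol–Euler, the single prime `q = p₁` off `ρ_{p₂}`), with no cofinality and no avoidance of
`N ℓ N_W` (gen 3 needed `p' > N ℓ N_W`).  With `(p₁, p₂) = (3, 5)` these are exactly the Deligne
inputs an honest `R = T` proof of the co-stubs `stub_liftThree` (at `3`) and `stub_liftFive` (at `5`)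
consumes, so S9's named-fact debt is contained in theirs plus Carayol.
-/

noncomputable section

open scoped NumberField Polynomial MatrixGroups ModularForm
open NumberField IsDedekindDomain IsDedekindDomain.HeightOneSpectrum Field Polynomial
open CongruenceSubgroup Rat.HeightOneSpectrum
open Literature.NumberTheory.EllipticCurves
open Literature.NumberTheory.EllipticCurves.ModularForms
open Literature.NumberTheory.Automorphic
open Literature.NumberTheory.Automorphic.BCDT
open Literature.NumberTheory.GaloisRepresentations
open WeierstrassCurve

namespace Summit.ABC.ABC.Cruxes.FreyModularity.Sketch.StubIdeasThreeImpTwo1G5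

/-- The registered stub's type, character for character (`Lines/Sketch.lean`, `stub_threeImpTwo`). -/
def SigS9 : Prop :=
  ∀ (W : WeierstrassCurve ℚ) [W.IsElliptic] [NeZero (W.conductorNorm ℤ)] (ℓ : ℕ) [Fact ℓ.Prime],
    W.IsModularGaloisRepTate ℓ → BCDT.IsModular W

example : SigS9 = (∀ (W : WeierstrassCurve ℚ) [W.IsElliptic] [NeZero (W.conductorNorm ℤ)] (ℓ : ℕ)
    [Fact ℓ.Prime], W.IsModularGaloisRepTate ℓ → BCDT.IsModular W) := rfl

/-- **`R(p)` — Deligne realisation of RATIONAL weight-two `Γ₀`-newforms at the FIXED prime `p`, in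
Carayol's currency**: for every rational newform `f₀ ∈ S₂(Γ₀(N))` and every `ι : ℚ̄_p ≃ ℂ` an
irreducible `ρ : Γ_ℚ → GL₂(ℚ̄_p)` attached to `liftToGamma1 N 2 f₀` away from `N p`
(`IsGaloisRepOfNewform1`, coefficient map `ι⁻¹ ∘ (K_g ⊆ ℂ)`).  Verbatim the inner body of gen-3's
`RatNewformGaloisRepCofinal` at one prime; verbatim the hypothesis shape consumed by
`Carayol1986_eulerFactor` and `Carayol1986_artinConductorExponent`. -/
def RealisationAt (p : ℕ) [Fact p.Prime] : Prop :=
  ∀ {N : ℕ} [NeZero N] (f₀ : CuspForm (Gamma0 N) 2), IsNewform0 f₀ →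
    (∀ n : ℕ, ∃ z : ℤ, cuspCoeff f₀ n = z) → ∀ ι : PadicAlgCl p ≃+* ℂ,
      ∃ ρ : FramedGaloisRep ℚ (PadicAlgCl p) 2,
        IsGaloisRepOfNewform1 (liftToGamma1 N 2 f₀)
          ((ι.symm : ℂ →+* PadicAlgCl p).comp (algebraMap (coeffCharField (liftToGamma1 N 2 f₀)) ℂ))
          {q | q ∣ N * p} ρ ∧
        ρ.toGaloisRep.IsIrreducible

/-- **L3 (XS, PROVED).** `Hida 3.26 (1)` (catalogued; `= thm61_exists_adicGaloisRep` by the tree's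
`Hida2000_thm326_exists_galoisRep_of_thm61`) gives `R(p)` at every `p`. -/
theorem realisationAt_of_hida (hD : Hida2000_thm326_exists_galoisRep) (p : ℕ) [Fact p.Prime] :
    RealisationAt p := by
  intro N _ f₀ hf₀ _ ι
  exact hD (liftToGamma1 N 2 f₀) le_rfl
    ((isNewform1_liftToGamma1_iff_holds (N := N) (k := 2) f₀).mpr hf₀) p ι

/-- **L4 (S/M).** For RATIONAL newforms the ONE-completion Deligne fact
`exists_padicGaloisRep_of_isNewform1` (the shape the `stub_liftThree` card consumes; `ρ` over some
finite `E ⊇ ℚ_p`, absolutely irreducible) already gives `R(p)`: base-change `ρ` along a continuous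
`ℚ_p`-embedding `E → ℚ̄_p` (`IsAlgClosed.lift`, `IsModuleTopology.continuous_of_linearMap`,
`FramedGaloisRep.isUnramifiedAt_baseChange_iff`, `hasFrobCharpolyAt_baseChange`); the coefficient maps
agree on the Hecke polynomials because `a_q(f₀) ∈ ℤ` and `ε = 1` (`map_heckePolynomial`,
`coe_liftToGamma1_holds`, `nebentypus_liftToGamma1_holds`, as in gen-3's
`ratNewformGaloisRepCofinal_of_eichlerShimuraWeak`).  The "one completion only" caveat of
`NewformGaloisRepPadicAlgClProofs` is void here: `K_{f₀} = ℚ` has one place above `p`. -/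
theorem realisationAt_of_exists_padicGaloisRep
    (hDel : ∀ {N : ℕ} [NeZero N] (f : CuspForm (Gamma1 N) 2),
      exists_padicGaloisRep_of_isNewform1 (f := f))
    (p : ℕ) [Fact p.Prime] : RealisationAt p := by
  sorry

/-- **L5 (M; PROVED in gen 3 as the `q ≠ p'` branch of `key`).**  One realisation `ρ_g` of the
rational newform `f₀` at `p'`, plus `a_q(f₀) = a_q(W)` off a finite set (from the hypothesis of S9)
and Carayol–Euler, gives `a_q(f₀) = a_q(W)` and `q ∣ N ↔ q ∣ N_W` at EVERY prime `q ≠ p'`: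
`ρ_g ≅ V_{p'}W ⊗ ℚ̄` (Chebotarev density + Brauer–Nesbitt + irreducibility of `ρ_g`, gen-3 `H2'` via
`nonempty_equiv_twist_of_isGaloisRepOfNewform1` at `ψ = 1`), then the Euler factor of `ρ_g` at `q`
(Carayol) equals that of `V_{p'}W` (Grothendieck / Néron–Ogg–Shafarevich side, gen-3 `H3`), whose
linear coefficient and degree give both conjuncts (gen-3 `H4`). -/
theorem cuspCoeff_eq_and_dvd_iff_of_realisation (hCE : Carayol1986_eulerFactor)
    (W : WeierstrassCurve ℚ) [W.IsElliptic] {N : ℕ} [NeZero N] (f₀ : CuspForm (Gamma0 N) 2)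
    (hf₀ : IsNewform0 f₀) {T₀ : ℕ} (hT₀ : T₀ ≠ 0)
    (hfp : ∀ p : ℕ, p.Prime → ¬ p ∣ T₀ → cuspCoeff f₀ p = (W.LFunction p : ℂ))
    (p' : ℕ) [Fact p'.Prime] (ι : PadicAlgCl p' ≃+* ℂ) (ρg : FramedGaloisRep ℚ (PadicAlgCl p') 2)
    (hρg : IsGaloisRepOfNewform1 (liftToGamma1 N 2 f₀)
      ((ι.symm : ℂ →+* PadicAlgCl p').comp (algebraMap (coeffCharField (liftToGamma1 N 2 f₀)) ℂ))
      {q | q ∣ N * p'} ρg)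
    (hirr : ρg.toGaloisRep.IsIrreducible) (q : ℕ) (hq : q.Prime) (hqp : q ≠ p') :
    cuspCoeff f₀ q = (W.LFunction q : ℂ) ∧ (q ∣ N ↔ q ∣ W.conductorNorm ℤ) := by
  sorry

/-- **H5 (S; PROVED in gen 3 as `H5_isNewformOf_of_forall_prime_cuspCoeff_eq_of_dvd_iff`).**
Matching prime coefficients and matching bad-prime pattern give `aₙ(f₀) = aₙ(W)` for all `n` (both
sides multiplicative; prime powers by the Hecke / Euler recursions with `𝟙_N(q) = 𝟙_{N_W}(q)`). -/
theorem isNewformOf_of_forall_prime (W : WeierstrassCurve ℚ) [W.IsElliptic] {N : ℕ} [NeZero N]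
    {f₀ : CuspForm (Gamma0 N) 2} (hf₀ : IsNewform0 f₀)
    (hdvd : ∀ q : ℕ, q.Prime → (q ∣ N ↔ q ∣ W.conductorNorm ℤ))
    (hfp : ∀ q : ℕ, q.Prime → cuspCoeff f₀ q = (W.LFunction q : ℂ)) : IsNewformOf W f₀ := by
  sorry

/-- **L6 (two-prime core, PROVED from L5 + H5).**  `ρ_{E,ℓ}` modular, realisations of rational
newforms at two DISTINCT primes `p₁ ≠ p₂`, Carayol–Euler ⇒ `E` has a newform with `aₙ(f₀) = aₙ(E)`
at SOME level `N` with the same prime support as `N_E`.  No cofinality, no size condition on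
`p₁, p₂` relative to `N ℓ N_E` (contrast gen-3's `p' > N ℓ N_E`): every prime `q ≠ p₁` is read off
`ρ_{p₁}`, and `q = p₁` off `ρ_{p₂}`.  In particular `ℓ` itself — the hole of the hypothesis — is
covered whichever of `p₁, p₂` it equals or not. -/
theorem exists_isNewformOf_of_two_realisations (hCE : Carayol1986_eulerFactor)
    {p₁ p₂ : ℕ} [Fact p₁.Prime] [Fact p₂.Prime] (hne : p₁ ≠ p₂)
    (h₁ : RealisationAt p₁) (h₂ : RealisationAt p₂)
    (W : WeierstrassCurve ℚ) [W.IsElliptic] [NeZero (W.conductorNorm ℤ)] (ℓ : ℕ) [Fact ℓ.Prime]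
    (h : W.IsModularGaloisRepTate ℓ) :
    ∃ (N : ℕ) (_ : NeZero N) (f₀ : CuspForm (Gamma0 N) 2), IsNewformOf W f₀ := by
  classical
  have hℓ : ℓ.Prime := Fact.out
  obtain ⟨N, hN, f₀, hf₀, hrat, hfp⟩ := exists_rational_isNewform0_of_isModularGaloisRepTate' W ℓ h
  have hT₀ : N * (ℓ * W.conductorNorm ℤ) ≠ 0 :=
    mul_ne_zero (NeZero.ne N) (mul_ne_zero hℓ.ne_zero (NeZero.ne _))
  obtain ⟨ι₁⟩ := PadicAlgCl.nonempty_ringEquiv_complex p₁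
  obtain ⟨ι₂⟩ := PadicAlgCl.nonempty_ringEquiv_complex p₂
  obtain ⟨ρ₁, hρ₁, hirr₁⟩ := h₁ f₀ hf₀ hrat ι₁
  obtain ⟨ρ₂, hρ₂, hirr₂⟩ := h₂ f₀ hf₀ hrat ι₂
  have key : ∀ q : ℕ, q.Prime →
      cuspCoeff f₀ q = (W.LFunction q : ℂ) ∧ (q ∣ N ↔ q ∣ W.conductorNorm ℤ) := by
    intro q hq
    by_cases hq₁ : q = p₁
    · exact cuspCoeff_eq_and_dvd_iff_of_realisation hCE W f₀ hf₀ hT₀ hfp p₂ ι₂ ρ₂ hρ₂ hirr₂ q hq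
        (hq₁ ▸ hne)
    · exact cuspCoeff_eq_and_dvd_iff_of_realisation hCE W f₀ hf₀ hT₀ hfp p₁ ι₁ ρ₁ hρ₁ hirr₁ q hq hq₁
  exact ⟨N, hN, f₀, isNewformOf_of_forall_prime W hf₀ (fun q hq ↦ (key q hq).2)
    fun q hq ↦ (key q hq).1⟩

/-- **L7 (PROVED from L6): the verbatim stub from `R(p₁)`, `R(p₂)` (`p₁ ≠ p₂`), Carayol–Euler and the
catalogued level fact `IsNewformOf.level_eq_conductorNorm` (= Carayol Artin exponent + Saito at `2`,
`IsNewformOf.level_eq_conductorNorm_of_carayol_of_saito'`).** -/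
theorem sigS9_of_two_realisations (hCE : Carayol1986_eulerFactor)
    {p₁ p₂ : ℕ} [Fact p₁.Prime] [Fact p₂.Prime] (hne : p₁ ≠ p₂)
    (h₁ : RealisationAt p₁) (h₂ : RealisationAt p₂)
    (hC : ∀ (N : ℕ) [NeZero N], IsNewformOf.level_eq_conductorNorm (N := N)) : SigS9 := by
  intro W _ _ ℓ _ h
  obtain ⟨N, hN, f₀, hWf⟩ := exists_isNewformOf_of_two_realisations hCE hne h₁ h₂ W ℓ h
  have hNW : N = W.conductorNorm ℤ := hC N hWf
  subst hNW
  exact ⟨f₀, hWf⟩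

/-- **The cross-prime instance `(p₁, p₂) = (3, 5)`** — the two primes at which the co-stubs
`stub_liftThree` / `stub_liftFive` already owe Deligne's representations. PROVED from L7. -/
theorem sigS9_of_realisationAt_three_five (hCE : Carayol1986_eulerFactor)
    (h3 : @RealisationAt 3 ⟨Nat.prime_three⟩) (h5 : @RealisationAt 5 ⟨by norm_num⟩)
    (hC : ∀ (N : ℕ) [NeZero N], IsNewformOf.level_eq_conductorNorm (N := N)) : SigS9 :=
  haveI : Fact (Nat.Prime 3) := ⟨Nat.prime_three⟩
  haveI : Fact (Nat.Prime 5) := ⟨by norm_num⟩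
  sigS9_of_two_realisations hCE (p₁ := 3) (p₂ := 5) (by decide) h3 h5 hC

/-- Gen-1/3's closer recovered: Hida 3.26 (1) + Carayol–Euler + the level fact ⇒ S9. PROVED. -/
theorem sigS9_of_hida_of_carayolEuler (hD : Hida2000_thm326_exists_galoisRep)
    (hCE : Carayol1986_eulerFactor)
    (hC : ∀ (N : ℕ) [NeZero N], IsNewformOf.level_eq_conductorNorm (N := N)) : SigS9 :=
  haveI : Fact (Nat.Prime 3) := ⟨Nat.prime_three⟩
  haveI : Fact (Nat.Prime 5) := ⟨by norm_num⟩
  sigS9_of_two_realisations hCE (p₁ := 3) (p₂ := 5) (by decide)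
    (realisationAt_of_hida hD 3) (realisationAt_of_hida hD 5) hC

/-- **Per curve, semistable (`N_W` squarefree — case A Frey curves away from the `2`-part): no level
fact at all**, the level is read off `q`-expansions (`IsNewformOf.level_eq_conductorNorm_of_squarefree`,
PROVED in the tree). PROVED from L6. -/
theorem isModular_of_two_realisations_of_squarefree (hCE : Carayol1986_eulerFactor)
    {p₁ p₂ : ℕ} [Fact p₁.Prime] [Fact p₂.Prime] (hne : p₁ ≠ p₂)
    (h₁ : RealisationAt p₁) (h₂ : RealisationAt p₂)
    (W : WeierstrassCurve ℚ) [W.IsElliptic] [NeZero (W.conductorNorm ℤ)]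
    (hsq : Squarefree (W.conductorNorm ℤ)) (ℓ : ℕ) [Fact ℓ.Prime]
    (h : W.IsModularGaloisRepTate ℓ) : BCDT.IsModular W := by
  obtain ⟨N, hN, f₀, hWf⟩ := exists_isNewformOf_of_two_realisations hCE hne h₁ h₂ W ℓ h
  have hNW : N = W.conductorNorm ℤ := hWf.level_eq_conductorNorm_of_squarefree hsq
  subst hNW
  exact ⟨f₀, hWf⟩

/-- **L1 (XS, PROVED): umbrella seat wiring.**  Under the modularity theorem `exists_isNewformOf`
(BCDT Thm. A, catalogued) the stub is immediate (`BCDT.exists_isNewformOf_iff` is `Iff.rfl`); this is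
the header a prover lands `--supports stmt-ABC-11340 --as helper` if the route is ever re-glued on
Theorem A. -/
theorem sigS9_of_exists_isNewformOf (hA : exists_isNewformOf) : SigS9 :=
  fun W _ _ _ _ _ ↦ BCDT.exists_isNewformOf_iff.mp hA W

end Summit.ABC.ABC.Cruxes.FreyModularity.Sketch.StubIdeasThreeImpTwo1G5

end
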